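import Literature.Geometry.Lorentzian.KerrRpBulk
import HarnessLib

/-!
# Flux densities through the radial graph hypersurfaces `{t* = τ + k(r)}` of the Kerr–Schild chart
# in the null frame: the `V`-energy and the `r^p`-current, exactly

(family `gr`; infrastructure for the far-region `r^p`-weighted estimates behind statement **gr.S24**
— the named fact `Kerr.dafermosRodnianski_pHierarchy_scri` of `KerrDecayHierarchy.lean` — in the
coefficient-field framework of `KerrSchild.multiplierCurrent`; namespace
`Literature.Geometry.Lorentzian.Kerr`)

The leaves `Σ̃_τ(h♯_{R₁}) = {t* = τ + h♯_{R₁}(y)}` of `KerrHyperboloidalFlux.lean` are graphs of a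
function of the Kerr–Schild radius, `h♯_{R₁}(y) = k♯_{R₁}(r(0, y))`, so their conormal is
`n = dt* − k′(r) dr` (`Kerr.graphConormal`, `KerrEnergyIdentity.lean`); the time slices `{t* = T}` of
the truncation arguments (`KerrSchildTruncatedCurrent.lean`) are the case `k′ = 0`. For such a
**radial conormal** `ν_c = dt* − c dr` (`Kerr.radialConormal a x c`, `c ∈ ℝ`) this file computes,
exactly and in the frame functionals `u = p(m)`, `v = p(k)`, `|p̸|²`, `B_r = p̸·∇̸r` of a covector
`p = dΦ(x)` (`KerrNullFrame.lean`), the flux densities `−∑_μ (J^X)^μ ν_μ` (the dominant-energy sign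
convention of `KerrSchildLeafCurrents.lean`: energy `= −`flux) of the two currents of the method:

* `Kerr.graphConormal_cutoffHeight_eq_radialConormal`, `Kerr.graphConormal_scriHeight_eq_radialConormal`
  — the conormal `Kerr.graphConormal` of the leaves of a cut-off graph foliation (in particular of
  `Σ̃_τ(h♯_{R₁})`) at `x` *is* `radialConormal a x (k′(r(x)))`, `k′ = χ((r − R₁)/R₁) σ(r)`;
* `Kerr.neg_sum_multiplierCurrent_timeVector_radialConormal` — **the `V`-energy density**
  (`V = −g♯dt*`; for `c = k′(r)` this is the density `T[ψ](V, W_h)` of `Kerr.leafFluxDensity` in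
  coordinates, `Kerr.stressEnergy_timeVector_leafNormal_eq` of `KerrSchildLeafCurrents.lean`):
  `−∑ (J^V)^μ ν_μ = ¼(1 + c) u² + ½(1 + 2H + 2Hc)|p̸|² + ¼(1 + 2H)((1 + 2H) − c(1 − 2H)) v²
     + c (½u + ½(1 + 2H)v) B_r`.
  There is no `u v` term, and the coefficient of the transversal derivative `v²` is
  `¼(1 + 2H)(1 − 2H)(c_null − c)` with `c_null = (1 + 2H)/(1 − 2H)` the outgoing null slope
  `dt*/dr` of the chart (`Kerr.vSq_coeff_eq`): it degenerates exactly as the graph becomes null —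
  the origin of the weight `r⁻²` on `(Tψ)²` in the hyperboloidal energies of DRSR §3.3 / Moschidis
  (for the leaves `Σ̃_τ(h♯)`, `c = σ♯` and `c_null − c = 2M(2Mr − a²)/(rΔ)`,
  `Kerr.outgoingNullSlope_sub_scriSlope`);
* `Kerr.neg_sum_multiplierCurrent_timeVector_radialConormal_le` — the **upper bound with the
  degenerate weight**: for every real `c`,
  `−∑ (J^V)^μ ν_μ ≤ (¼(1+c) + ¼) u² + (½(1 + 2H + 2Hc) + ¼c²a²/r² + ½)|p̸|²
     + (¼(1+2H)((1+2H) − c(1−2H)) + c²(1+2H)²a²/(8r²)) v²`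
  (`B_r² ≤ |p̸|² a²/r²`): the converse of `Kerr.leafCoercivity_pointwise` (`KerrLeafCoercivity.lean`)
  with the *sharp* weight on `v²`, which is what turns the `p = 1` bulk (`½ u² + ½|p̸|²`, weight
  `r⁰`; `KerrRpBulk.lean`) plus the far Morawetz bulk (all derivatives, weight `r^{-1-δ}`;
  `KerrLargeRCurrent.lean`) into a bound for the time-integrated flux through the leaves — clause
  (B2) of `Kerr.dafermosRodnianski_pHierarchy_scri`;
* `Kerr.neg_sum_multiplierCurrent_smul_outVector_radialConormal` — **the density of the
  `r^p`-current** `J^{fm}`, for any coefficient field `φ g⁻¹` conformal to the Kerr one (the density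
  is `C⁰`-linear in the coefficient field):
  `−∑ (J^{fm}[φg⁻¹])^μ ν_μ = φ f (½(1 + c) u² + ½((1 + 2H) − c(1 − 2H))|p̸|² + c u B_r)` — no `v` at
  all (a current along a null vector: through the null cone `c = c_null` only `u²` survives, the
  `∫ r^p (∂_vΨ)² dv` of Dafermos–Rodnianski), and through the time slices (`c = 0`)
  `φ f(½u² + ½(1 + 2H)|p̸|²) ≥ 0` (`Kerr.neg_sum_multiplierCurrent_smul_outVector_timeConormal_nonneg`:
  the dominant energy condition for the future null multiplier `m`, explicitly).

It also provides the elementary algebra used here and by `KerrRpCoercivity.lean`: weighted means,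
the components `p̸_i` of the angular part and **Cauchy–Schwarz for the angular pairing**
(`Kerr.frameAng_sq_le`), `|p̸|²` of linear combinations, and the far-region bounds `r² ≤ Σ ≤ 2r²`
(`r ≥ |a|`), `z² ≤ r²`, `|∂_{ℓ♯}H| ≤ M/r²`, `ℓ⃗·∇r = 1`, `|∇̸r|² = (r² + a²)/Σ − 1 ≤ a²/r²`. All
statements are pointwise, at points with `r > 0`, for all real `M, a` (`M ≥ 0` where signs are
needed). No named facts (D-0026).

## References

* M. Dafermos, I. Rodnianski, Y. Shlapentokh-Rothman, arXiv:1402.7034 = Ann. of Math. 183 (2016),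
  §2.3.1 (`J^V_μ n^μ`), §3.3 (the hyperboloidal leaves) (key `DafermosRodnianskiShlapentokhrothman2014`).
* M. Dafermos, I. Rodnianski, arXiv:0910.4957, §3–§4 (the boundary terms `∫ r^p(∂_vψ)² dv` of the
  `r^p` identities) (key `DafermosRodnianski2010ICMP`).
* G. Moschidis, arXiv:1509.08489 = Ann. PDE 2 (2016), §3.1 (hyperboloids terminating at `𝓘⁺`), Thm.
  5.1 (`E^{(p)}_bound`) (key `Moschidis2016`).
* M. Visser, arXiv:0706.0622, (33)–(35) (key `arXiv07060622`).
-/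

noncomputable section

open Set Filter
open scoped Topology

namespace Literature.Geometry.Lorentzian.Kerr

variable {M a : ℝ} {x : E4}

/-! ### Algebra: weighted means, Cauchy–Schwarz for the angular pairing -/

/-- Weighted arithmetic–geometric mean: `2XY ≤ αX² + βY²` when `α > 0`, `αβ ≥ 1`. [folklore] -/
theorem two_mul_le_of_one_le_mul {α β X Y : ℝ} (hα : 0 < α) (hαβ : 1 ≤ α * β) :
    2 * X * Y ≤ α * X ^ 2 + β * Y ^ 2 := by
  have h : α * (2 * X * Y) ≤ α * (α * X ^ 2 + β * Y ^ 2) := by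
    nlinarith [sq_nonneg (α * X - Y), mul_nonneg (sub_nonneg.2 hαβ) (sq_nonneg Y)]
  exact le_of_mul_le_mul_left h hα

/-- `|2XY| ≤ αX² + βY²` when `α > 0`, `αβ ≥ 1` (both signs). [folklore] -/
theorem abs_two_mul_le_of_one_le_mul {α β X Y : ℝ} (hα : 0 < α) (hαβ : 1 ≤ α * β) :
    |2 * X * Y| ≤ α * X ^ 2 + β * Y ^ 2 := by
  rw [abs_le]
  refine ⟨?_, two_mul_le_of_one_le_mul hα hαβ⟩
  have h := two_mul_le_of_one_le_mul (X := X) (Y := -Y) hα hαβ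
  rw [neg_sq] at h
  linarith

/-- `4PQ ≤ (P + Q)²`. [folklore] -/
theorem four_mul_le_sq_add (P Q : ℝ) : 4 * P * Q ≤ (P + Q) ^ 2 := by
  nlinarith [sq_nonneg (P - Q)]

/-- The angular part `p̸ = p⃗ − (ℓ⃗·p⃗) ℓ⃗` of a covector: its components. [folklore] -/
def angPart (a : ℝ) (x : E4) (p : Fin 4 → ℝ) (i : Fin 3) : ℝ :=
  p i.succ - spatialDotNull a x p * nullCovectorFun a x i.succ

/-- `p̸·q̸ = ∑_i p̸_i q̸_i` (uses `|ℓ⃗| = 1`). [folklore] -/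
theorem frameAng_eq_sum_angPart (hx : 0 < radius a x) (p q : Fin 4 → ℝ) :
    frameAng a x p q = ∑ i : Fin 3, angPart a x p i * angPart a x q i := by
  have hl := sum_sq_nullCovectorFun hx
  simp only [frameAng, angPart, spatialDotNull_eq, Fin.sum_univ_three, Fin.succ_zero_eq_one,
    Fin.succ_one_eq_two, fin_succ_two_eq_three]
  linear_combination (-(nullCovectorFun a x 1 * p 1 + nullCovectorFun a x 2 * p 2 +
    nullCovectorFun a x 3 * p 3) * (nullCovectorFun a x 1 * q 1 + nullCovectorFun a x 2 * q 2 +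
    nullCovectorFun a x 3 * q 3)) * hl

/-- `|p̸|² = ∑_i p̸_i²`. [folklore] -/
theorem frameAngSq_eq_sum_angPart (hx : 0 < radius a x) (p : Fin 4 → ℝ) :
    frameAngSq a x p = ∑ i : Fin 3, angPart a x p i ^ 2 := by
  rw [← frameAng_self, frameAng_eq_sum_angPart hx]
  exact Finset.sum_congr rfl fun i _ ↦ by ring

/-- **Cauchy–Schwarz for the angular pairing**: `(p̸·q̸)² ≤ |p̸|² |q̸|²`. [folklore] -/
theorem frameAng_sq_le (hx : 0 < radius a x) (p q : Fin 4 → ℝ) :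
    frameAng a x p q ^ 2 ≤ frameAngSq a x p * frameAngSq a x q := by
  rw [frameAng_eq_sum_angPart hx, frameAngSq_eq_sum_angPart hx, frameAngSq_eq_sum_angPart hx]
  simp only [Fin.sum_univ_three]
  set P₁ := angPart a x p 0
  set P₂ := angPart a x p 1
  set P₃ := angPart a x p 2
  set Q₁ := angPart a x q 0
  set Q₂ := angPart a x q 1
  set Q₃ := angPart a x q 2
  nlinarith [sq_nonneg (P₁ * Q₂ - P₂ * Q₁), sq_nonneg (P₁ * Q₃ - P₃ * Q₁), sq_nonneg (P₂ * Q₃ - P₃ * Q₂)]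

/-- `|p̸|²` of a linear combination: `|(αp + βq)̸|² ≤ 2α²|p̸|² + 2β²|q̸|²`. [folklore] -/
theorem frameAngSq_lincomb_le (hx : 0 < radius a x) (p q : Fin 4 → ℝ) (α β : ℝ) :
    frameAngSq a x (fun μ ↦ α * p μ + β * q μ) ≤ 2 * α ^ 2 * frameAngSq a x p + 2 * β ^ 2 * frameAngSq a x q := by
  have hlin : ∀ i, angPart a x (fun μ ↦ α * p μ + β * q μ) i = α * angPart a x p i + β * angPart a x q i := by
    intro i
    simp only [angPart, spatialDotNull]
    have : ∑ j : Fin 3, nullCovectorFun a x j.succ * (α * p j.succ + β * q j.succ) =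
        ∑ j : Fin 3, (α * (nullCovectorFun a x j.succ * p j.succ) + β * (nullCovectorFun a x j.succ * q j.succ)) :=
      Finset.sum_congr rfl fun j _ ↦ by ring
    rw [this, Finset.sum_add_distrib, ← Finset.mul_sum, ← Finset.mul_sum]
    ring
  rw [frameAngSq_eq_sum_angPart hx, frameAngSq_eq_sum_angPart hx, frameAngSq_eq_sum_angPart hx]
  simp only [hlin, Fin.sum_univ_three]
  nlinarith [sq_nonneg (α * angPart a x p 0 - β * angPart a x q 0),
    sq_nonneg (α * angPart a x p 1 - β * angPart a x q 1),
    sq_nonneg (α * angPart a x p 2 - β * angPart a x q 2)]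

/-- `|p̸|²` is unchanged by the time component and scales quadratically: the frame functionals of
the covector `(c_μ p_μ)`-type combinations used below. `|(c p)̸|² = c² |p̸|²`. [folklore] -/
theorem frameAngSq_smul (a : ℝ) (x : E4) (p : Fin 4 → ℝ) (c : ℝ) :
    frameAngSq a x (fun μ ↦ c * p μ) = c ^ 2 * frameAngSq a x p := by
  simp only [frameAngSq, spatialDotNull, Fin.sum_univ_three]
  ring

/-! ### Far-region bounds on Kerr: `Σ`, `∂_{ℓ♯}H`, `∇̸r` -/

/-- `Σ = r² + a² z²/r²` (from `r²Σ = r⁴ + a²z²`). [cite: arXiv07060622, (33)–(35)] -/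
theorem blSigma_spatial_eq_sq_add (hx : 0 < radius a x) :
    blSigma a (E4.spatial x) = radius a x ^ 2 + a ^ 2 * x 3 ^ 2 / radius a x ^ 2 := by
  have h := sq_mul_blSigma_spatial a x
  have hr : radius a x ≠ 0 := hx.ne'
  field_simp
  linear_combination h

/-- **`r² ≤ Σ`.** [folklore] -/
theorem sq_le_blSigma_spatial (hx : 0 < radius a x) : radius a x ^ 2 ≤ blSigma a (E4.spatial x) := by
  rw [blSigma_spatial_eq_sq_add hx]
  have : 0 ≤ a ^ 2 * x 3 ^ 2 / radius a x ^ 2 := by positivity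
  linarith

/-- `z² ≤ r²` (`χ = z/r` has `χ² ≤ 1`). [cite: arXiv07060622, (35)] -/
theorem sq_apply_three_le_sq (hx : 0 < radius a x) : x 3 ^ 2 ≤ radius a x ^ 2 := by
  have h := sq_latitude_le_one (a := a) hx
  rw [latitude, div_pow, div_le_one (by positivity)] at h
  exact h

/-- **`Σ ≤ 2r²` for `r ≥ |a|`.** [folklore] -/
theorem blSigma_spatial_le_two_mul_sq (hx : 0 < radius a x) (ha : |a| ≤ radius a x) :
    blSigma a (E4.spatial x) ≤ 2 * radius a x ^ 2 := by
  rw [blSigma_spatial_eq_sq_add hx]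
  have hz := sq_apply_three_le_sq (a := a) hx
  have ha2 : a ^ 2 ≤ radius a x ^ 2 := by
    rw [← sq_abs a]; exact pow_le_pow_left₀ (abs_nonneg a) ha 2
  have h1 : a ^ 2 * x 3 ^ 2 / radius a x ^ 2 ≤ a ^ 2 := by
    rw [div_le_iff₀ (by positivity)]
    exact mul_le_mul_of_nonneg_left hz (sq_nonneg a)
  linarith

/-- **`|∂_{ℓ♯}H| ≤ M/r²`** for `M ≥ 0`, `r ≥ |a|` (`∂_{ℓ♯}H = M(Σ − 2r²)/Σ²`, `r² ≤ Σ ≤ 2r²`).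
[cite: arXiv07060622, (33)] -/
theorem abs_fderiv_scalarH_nullVector_le (hM : 0 ≤ M) (hx : 0 < radius a x) (ha : |a| ≤ radius a x) :
    |fderiv ℝ (scalarH M a) x (nullVector a x)| ≤ M / radius a x ^ 2 := by
  have hS := blSigma_spatial_pos hx
  have h1 := sq_le_blSigma_spatial (a := a) hx
  have h2 := blSigma_spatial_le_two_mul_sq hx ha
  rw [fderiv_scalarH_nullVector M hx, abs_div, abs_of_pos (by positivity : (0 : ℝ) < blSigma a (E4.spatial x) ^ 2),
    div_le_div_iff₀ (by positivity) (by positivity), abs_mul, abs_of_nonneg hM]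
  have h3 : |blSigma a (E4.spatial x) - 2 * radius a x ^ 2| ≤ radius a x ^ 2 := by
    rw [abs_le]; constructor <;> linarith
  calc M * |blSigma a (E4.spatial x) - 2 * radius a x ^ 2| * radius a x ^ 2
      ≤ M * radius a x ^ 2 * radius a x ^ 2 := by
        rw [mul_assoc, mul_assoc]; exact mul_le_mul_of_nonneg_left (mul_le_mul_of_nonneg_right h3 (sq_nonneg _)) hM
    _ ≤ M * blSigma a (E4.spatial x) ^ 2 := by
        rw [mul_assoc]; exact mul_le_mul_of_nonneg_left (by nlinarith) hM

/-- `ℓ⃗·∇r = 1` as the null component of the covector `dr`: `spatialDotNull (dr) = 1`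
(`∂_{ℓ♯}r = 1`, `∂_{t*}r = 0`). [cite: arXiv07060622, (35)] -/
theorem spatialDotNull_fderiv_radius (M : ℝ) (hx : 0 < radius a x) :
    spatialDotNull a x (fun μ ↦ fderiv ℝ (radius a) x (E4.basisVector μ)) = 1 := by
  have h := frameIn_fderiv_radius (a := a) hx
  rw [frameIn_eq] at h
  simp only [fderiv_radius_basisVector_zero a hx] at h
  have h2 := spatialDotNull_eq_frame M a x (fun μ ↦ fderiv ℝ (radius a) x (E4.basisVector μ))
  linarith

/-- **`|∇̸r|² = (r² + a²)/Σ − 1 ≤ a²/r²`**: the angular part of `dr` (`|∇r|² = (r² + a²)/Σ`,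
`ℓ⃗·∇r = 1`). [cite: arXiv07060622, (35)] -/
theorem frameAngSq_fderiv_radius_eq (M : ℝ) (hx : 0 < radius a x) :
    frameAngSq a x (fun μ ↦ fderiv ℝ (radius a) x (E4.basisVector μ)) =
      (radius a x ^ 2 + a ^ 2) / blSigma a (E4.spatial x) - 1 := by
  rw [frameAngSq, spatialDotNull_fderiv_radius M hx, sum_sq_fderiv_radius hx]
  ring

/-- `|∇̸r|² ≤ a²/r²`. [cite: arXiv07060622, (35)] -/
theorem frameAngSq_fderiv_radius_le (M : ℝ) (hx : 0 < radius a x) :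
    frameAngSq a x (fun μ ↦ fderiv ℝ (radius a) x (E4.basisVector μ)) ≤ a ^ 2 / radius a x ^ 2 := by
  rw [frameAngSq_fderiv_radius_eq M hx, div_sub_one (blSigma_spatial_pos hx).ne',
    div_le_div_iff₀ (blSigma_spatial_pos hx) (by positivity)]
  have h := sq_le_blSigma_spatial (a := a) hx
  nlinarith [sq_nonneg a]

/-! ### Contracting a multiplier current with a covector -/

/-- **`∑_μ (J^X)^μ ν_μ = g⁻¹(p, ν) X(p) − ½ ν(X) g⁻¹(p, p)`** for the current of
`KerrSchild.multiplierCurrent` (`p = dw(x)`), any coefficient field, multiplier and covector.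
[cite: DafermosRodnianskiShlapentokhrothman2014, §2.3.1] -/
theorem _root_.Literature.Geometry.Lorentzian.KerrSchild.sum_multiplierCurrent_mul
    (G : E4 → Fin 4 → Fin 4 → ℝ) (X : E4 → Fin 4 → ℝ) (w : E4 → ℝ) (x : E4) (ν : Fin 4 → ℝ) :
    ∑ μ, KerrSchild.multiplierCurrent G X w x μ * ν μ =
      (∑ μ, (∑ κ, G x μ κ * fderiv ℝ w x (E4.basisVector κ)) * ν μ) *
          (∑ α, X x α * fderiv ℝ w x (E4.basisVector α)) -
        2⁻¹ * (∑ μ, X x μ * ν μ) *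
          ∑ α, ∑ β, G x α β * fderiv ℝ w x (E4.basisVector α) * fderiv ℝ w x (E4.basisVector β) := by
  obtain ⟨p, hp⟩ : ∃ p : Fin 4 → ℝ, ∀ β, fderiv ℝ w x (E4.basisVector β) = p β := ⟨_, fun _ ↦ rfl⟩
  simp only [KerrSchild.multiplierCurrent, hp, Fin.sum_univ_four]
  ring

/-! ### Radial conormals and their frame components -/

/-- The **radial conormal** `ν_c = dt* − c dr` at `x`, in components `(δ_{μ0} − c ∂_μr)`: for
`c = k′(r(x))` the conormal `dt* − d(k∘r)` of the graph `{t* = τ + k(r)}` through `x` (the leaves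
`Σ̃_τ(h♯)` have `h♯ = k♯ ∘ r`), for `c = 0` the conormal `dt*` of the time slices.
[cite: DafermosRodnianskiShlapentokhrothman2014, §3.3] -/
def radialConormal (a : ℝ) (x : E4) (c : ℝ) (μ : Fin 4) : ℝ :=
  (if μ = 0 then 1 else 0) - c * fderiv ℝ (radius a) x (E4.basisVector μ)

/-- The time-slice conormal is `dt*`: `radialConormal a x 0 = (1, 0, 0, 0)`. [folklore] -/
theorem radialConormal_zero (a : ℝ) (x : E4) (μ : Fin 4) :
    radialConormal a x 0 μ = if μ = 0 then 1 else 0 := by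
  simp [radialConormal]

/-- `(δ₀ − c dr)(m) = (1 + 2H) − c(1 − 2H)` (`dr(m) = 1 − 2H`). [folklore] -/
theorem frameOut_radialConormal (M : ℝ) (hx : 0 < radius a x) (c : ℝ) :
    frameOut M a x (radialConormal a x c) = (1 + 2 * scalarH M a x) - c * (1 - 2 * scalarH M a x) := by
  have hdr := frameOut_fderiv_radius M a hx
  rw [frameOut_eq] at hdr ⊢
  simp only [spatialDotNull_eq, radialConormal, Fin.isValue, if_true, one_ne_zero, if_false,
    show (2 : Fin 4) ≠ 0 from by decide, show (3 : Fin 4) ≠ 0 from by decide, zero_sub,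
    fderiv_radius_basisVector_zero a hx, mul_zero, sub_zero] at hdr ⊢
  linear_combination (-c) * hdr

/-- `(δ₀ − c dr)(k) = 1 + c` (`dr(k) = −1`). [folklore] -/
theorem frameIn_radialConormal (hx : 0 < radius a x) (c : ℝ) :
    frameIn a x (radialConormal a x c) = 1 + c := by
  have hdr := frameIn_fderiv_radius (a := a) hx
  rw [frameIn_eq] at hdr ⊢
  simp only [spatialDotNull_eq, radialConormal, Fin.isValue, if_true, one_ne_zero, if_false,
    show (2 : Fin 4) ≠ 0 from by decide, show (3 : Fin 4) ≠ 0 from by decide, zero_sub,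
    fderiv_radius_basisVector_zero a hx, mul_zero, sub_zero] at hdr ⊢
  linear_combination (-c) * hdr

/-- The angular pairing with a radial conormal: `p̸·(δ₀ − c dr)̸ = −c (p̸·∇̸r)` (`dt*` has no spatial
part). [folklore] -/
theorem frameAng_radialConormal (a : ℝ) (x : E4) (p : Fin 4 → ℝ) (c : ℝ) :
    frameAng a x p (radialConormal a x c) = -c * frameAng a x p (fun μ ↦ fderiv ℝ (radius a) x (E4.basisVector μ)) := by
  simp only [frameAng, spatialDotNull_eq, radialConormal, Fin.sum_univ_three, Fin.succ_zero_eq_one,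
    Fin.succ_one_eq_two, fin_succ_two_eq_three, Fin.isValue, one_ne_zero, if_false,
    show (2 : Fin 4) ≠ 0 from by decide, show (3 : Fin 4) ≠ 0 from by decide, zero_sub]
  ring

/-- **`ν_c(V) = 1 + 2H + 2Hc`** for `V = −g♯dt*` (`dr(V) = −2H`). [folklore] -/
theorem sum_timeVector_mul_radialConormal (hx : 0 < radius a x) (c : ℝ) :
    ∑ μ, timeVector M a x μ * radialConormal a x c μ = 1 + 2 * scalarH M a x + 2 * scalarH M a x * c := by
  rw [sum_timeVector_mul_eq_frame, frameOut_radialConormal M hx, frameIn_radialConormal hx]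
  ring

/-- `ν_c(m) = (1 + 2H) − c(1 − 2H)` as a sum. [folklore] -/
theorem sum_outVector_mul_radialConormal (M : ℝ) (hx : 0 < radius a x) (c : ℝ) :
    ∑ μ, outVector M a x μ * radialConormal a x c μ = (1 + 2 * scalarH M a x) - c * (1 - 2 * scalarH M a x) :=
  frameOut_radialConormal M hx c

/-! ### The leaves `Σ̃_τ(h)` of a cut-off graph foliation have radial conormals -/

/-- **The conormal of a cut-off radial graph leaf is a radial conormal.** For a cut-off height
`h = cutoffHeight σ a R₁ = k ∘ r(0, ·)` (`k = cutoffProfile σ R₁`, `k′(r) = χ((r − R₁)/R₁) σ(r)`;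
the leaves `Σ̃_τ(h♯_{R₁})` are the case `σ = σ♯ = scriSlope M a`), at every point `x` with
`r(x) > ρ ≥ 0` (`σ` continuous on `(ρ, ∞) ∋ R₁`):
`graphConormal h (x⃗) = dt* − k′(r(x)) dr = radialConormal a x (k′(r(x)))`
(`dh = k′(r) dr`, `Kerr.hasFDerivAt_cutoffHeight`; `r(0, x⃗) = r(x)`). So the flux densities of this
file apply to the leaves with `c = k′(r)`. [cite: DafermosRodnianskiShlapentokhrothman2014, §3.3] -/
theorem graphConormal_cutoffHeight_eq_radialConormal {σ : ℝ → ℝ} {ρ R₁ : ℝ} (hρ : 0 ≤ ρ)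
    (hσ : ContinuousOn σ (Ioi ρ)) (hR : ρ < R₁) (hxρ : ρ < radius a x) (μ : Fin 4) :
    graphConormal (cutoffHeight σ a R₁) (E4.spatial x) μ =
      radialConormal a x (Real.smoothTransition ((radius a x - R₁) / R₁) * σ (radius a x)) μ := by
  have hx : 0 < radius a x := hρ.trans_lt hxρ
  have hy : ρ < radius a (E4.ofTimeSpace 0 (E4.spatial x)) := by rwa [radius_ofTimeSpace_spatial]
  have hh := hasFDerivAt_cutoffHeight (a := a) (R₁ := R₁) hρ hσ hR hy
  rw [radius_ofTimeSpace_spatial] at hh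
  refine Fin.cases ?_ (fun i ↦ ?_) μ
  · rw [graphConormal_zero, radialConormal, if_pos rfl, fderiv_radius_basisVector_zero a hx, mul_zero, sub_zero]
  · rw [graphConormal_succ, partialE3, hh.fderiv, radialConormal, if_neg (Fin.succ_ne_zero i),
      (hasFDerivAt_radius hx).fderiv, ContinuousLinearMap.comp_apply, E4.spatial_basisVector_succ,
      smul_apply, smul_eq_mul, zero_sub]

/-- The same for the leaves `Σ̃_τ(h♯_{R₁})` of `KerrHyperboloidalFlux.lean` (`|a| < M`, `R₁ > r₊`,
`r(x) > r₊`): `graphConormal h♯_{R₁} (x⃗) = radialConormal a x (χ((r − R₁)/R₁) σ♯(r))`.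
[cite: DafermosRodnianskiShlapentokhrothman2014, §3.3] -/
theorem graphConormal_scriHeight_eq_radialConormal (hMa : IsSubextremal M a) {R₁ : ℝ}
    (hR : rPlus M a < R₁) (hxr : rPlus M a < radius a x) (μ : Fin 4) :
    graphConormal (scriHeight M a R₁) (E4.spatial x) μ =
      radialConormal a x (Real.smoothTransition ((radius a x - R₁) / R₁) * scriSlope M a (radius a x)) μ := by
  rw [scriHeight_eq_cutoffHeight]
  exact graphConormal_cutoffHeight_eq_radialConormal hMa.rPlus_pos.le (contDiffOn_scriSlope hMa).continuousOn
    hR hxr μ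

/-! ### The `V`-energy density through a radial graph -/

/-- **The `V`-energy density through the radial graph with conormal `ν_c = dt* − c dr`, in the null
frame.** With `p = dΦ(x)`, `u = p(m)`, `v = p(k)`, `|p̸|²`, `B_r = p̸·∇̸r`:
`−∑_μ (J^V)^μ (ν_c)_μ = ¼(1 + c) u² + ½(1 + 2H + 2Hc) |p̸|² + ¼(1 + 2H)((1 + 2H) − c(1 − 2H)) v²
   + c (½ u + ½(1 + 2H) v) B_r`.
For `c = 0` (the Kerr–Schild slices) this is `T[ψ](V, V) = ¼u² + ½(1+2H)|p̸|² + ¼(1+2H)²v²`, for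
`c → c_null = (1+2H)/(1−2H)` the `v²`-coefficient tends to `0`. DRSR arXiv:1402.7034, §2.3.1, §3.3
(`J^V_μ n^μ_{Σ̃_τ}`), made explicit in Kerr–Schild components. [cite: DafermosRodnianskiShlapentokhrothman2014, §3.3] -/
theorem neg_sum_multiplierCurrent_timeVector_radialConormal (M a : ℝ) (hx : 0 < radius a x) (c : ℝ)
    (Φ : E4 → ℝ) :
    -∑ μ, KerrSchild.multiplierCurrent (inverseMetric M a) (fun y μ ↦ timeVector M a y μ) Φ x μ *
        radialConormal a x c μ =
      4⁻¹ * (1 + c) * frameOut M a x (fun μ ↦ fderiv ℝ Φ x (E4.basisVector μ)) ^ 2 +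
        2⁻¹ * (1 + 2 * scalarH M a x + 2 * scalarH M a x * c) *
          frameAngSq a x (fun μ ↦ fderiv ℝ Φ x (E4.basisVector μ)) +
        4⁻¹ * (1 + 2 * scalarH M a x) * ((1 + 2 * scalarH M a x) - c * (1 - 2 * scalarH M a x)) *
          frameIn a x (fun μ ↦ fderiv ℝ Φ x (E4.basisVector μ)) ^ 2 +
        c * (2⁻¹ * frameOut M a x (fun μ ↦ fderiv ℝ Φ x (E4.basisVector μ)) +
            2⁻¹ * (1 + 2 * scalarH M a x) * frameIn a x (fun μ ↦ fderiv ℝ Φ x (E4.basisVector μ))) *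
          frameAng a x (fun μ ↦ fderiv ℝ Φ x (E4.basisVector μ)) (fun μ ↦ fderiv ℝ (radius a) x (E4.basisVector μ)) := by
  obtain ⟨p, hp⟩ : ∃ p : Fin 4 → ℝ, ∀ β, fderiv ℝ Φ x (E4.basisVector β) = p β := ⟨_, fun _ ↦ rfl⟩
  have hpf : (fun μ ↦ fderiv ℝ Φ x (E4.basisVector μ)) = p := funext hp
  rw [KerrSchild.sum_multiplierCurrent_mul, hpf]
  simp only [hp]
  rw [sum_sum_inverseMetric_mul_mul_eq_frame, sum_timeVector_mul_eq_frame, sum_timeVector_mul_radialConormal hx,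
    sum_inverseMetric_mul_mul_self_eq_frame, frameOut_radialConormal M hx, frameIn_radialConormal hx,
    frameAng_radialConormal]
  ring

/-- **The `v²`-coefficient is `¼(1 + 2H)(1 − 2H)(c_null − c)`**, `c_null = (1 + 2H)/(1 − 2H)` the
outgoing null slope (where `2H < 1`): the `V`-energy density degenerates in the transversal
derivative exactly as the graph becomes null. [cite: DafermosRodnianskiShlapentokhrothman2014, §3.3] -/
theorem vSq_coeff_eq (H c : ℝ) (hH : 1 - 2 * H ≠ 0) :
    4⁻¹ * (1 + 2 * H) * ((1 + 2 * H) - c * (1 - 2 * H)) =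
      4⁻¹ * (1 + 2 * H) * (1 - 2 * H) * ((1 + 2 * H) / (1 - 2 * H) - c) := by
  field_simp

/-- **Upper bound of the `V`-energy density with the degenerate transversal weight.** For every real
`c`, at a point with `r > 0`:
`−∑ (J^V)^μ (ν_c)_μ ≤ (¼(1+c) + ¼) u² + (½(1 + 2H + 2Hc) + ¼ c² a²/r² + ½)|p̸|²
   + (¼(1+2H)((1+2H) − c(1−2H)) + c²(1+2H)² a²/(8r²)) v²`,
from the exact formula and `B_r² ≤ |p̸|² · a²/r²` (`|∇̸r|² ≤ a²/r²`). For the leaves `Σ̃_τ(h♯)`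
(`0 ≤ c = σ♯ ≤ c_null`, `c_null − c = O(M²/r²)`) every coefficient is `O(1)` except that of `v²`,
which is `O((M² + a²)/r²)`: `T[ψ](V, W) ≲ (mψ)² + |∇̸ψ|² + r⁻²(kψ)²` — the quantities controlled in the
far region by the `p = 1` bulk and the Morawetz bulk respectively. [cite: Moschidis2016, Thm. 5.1] -/
theorem neg_sum_multiplierCurrent_timeVector_radialConormal_le (M : ℝ) (hx : 0 < radius a x)
    (c : ℝ) (Φ : E4 → ℝ) :
    -∑ μ, KerrSchild.multiplierCurrent (inverseMetric M a) (fun y μ ↦ timeVector M a y μ) Φ x μ *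
        radialConormal a x c μ ≤
      (4⁻¹ * (1 + c) + 4⁻¹) * frameOut M a x (fun μ ↦ fderiv ℝ Φ x (E4.basisVector μ)) ^ 2 +
        (2⁻¹ * (1 + 2 * scalarH M a x + 2 * scalarH M a x * c) + 4⁻¹ * c ^ 2 * (a ^ 2 / radius a x ^ 2) + 2⁻¹) *
          frameAngSq a x (fun μ ↦ fderiv ℝ Φ x (E4.basisVector μ)) +
        (4⁻¹ * (1 + 2 * scalarH M a x) * ((1 + 2 * scalarH M a x) - c * (1 - 2 * scalarH M a x)) +
            c ^ 2 * (1 + 2 * scalarH M a x) ^ 2 * (a ^ 2 / radius a x ^ 2) / 8) *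
          frameIn a x (fun μ ↦ fderiv ℝ Φ x (E4.basisVector μ)) ^ 2 := by
  rw [neg_sum_multiplierCurrent_timeVector_radialConormal M a hx c Φ]
  set p : Fin 4 → ℝ := fun μ ↦ fderiv ℝ Φ x (E4.basisVector μ) with hp
  set u := frameOut M a x p with hu
  set v := frameIn a x p with hv
  set A := frameAngSq a x p with hA
  set B := frameAng a x p (fun μ ↦ fderiv ℝ (radius a) x (E4.basisVector μ)) with hB
  set H := scalarH M a x with hH
  have hA0 : 0 ≤ A := frameAngSq_nonneg hx p
  -- `B² ≤ A · a²/r²`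
  have hB2 : B ^ 2 ≤ A * (a ^ 2 / radius a x ^ 2) :=
    (frameAng_sq_le hx p _).trans (mul_le_mul_of_nonneg_left (frameAngSq_fderiv_radius_le M hx) hA0)
  -- term 1: `|c/2 · u · B| ≤ ¼u² + ¼c²(a²/r²)A`
  have h1 : |c * (2⁻¹ * u) * B| ≤ 4⁻¹ * u ^ 2 + 4⁻¹ * c ^ 2 * (a ^ 2 / radius a x ^ 2) * A := by
    have key : (c * (2⁻¹ * u) * B) ^ 2 ≤ (4⁻¹ * u ^ 2 + 4⁻¹ * c ^ 2 * (a ^ 2 / radius a x ^ 2) * A) ^ 2 := by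
      have e1 : (c * (2⁻¹ * u) * B) ^ 2 = 4⁻¹ * c ^ 2 * u ^ 2 * B ^ 2 := by ring
      have e2 : 4⁻¹ * c ^ 2 * u ^ 2 * B ^ 2 ≤ 4⁻¹ * c ^ 2 * u ^ 2 * (A * (a ^ 2 / radius a x ^ 2)) :=
        mul_le_mul_of_nonneg_left hB2 (by positivity)
      have e3 : 4⁻¹ * c ^ 2 * u ^ 2 * (A * (a ^ 2 / radius a x ^ 2)) =
          4 * (4⁻¹ * u ^ 2) * (4⁻¹ * c ^ 2 * (a ^ 2 / radius a x ^ 2) * A) := by ring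
      rw [e1]
      exact (e2.trans_eq e3).trans (four_mul_le_sq_add _ _)
    exact abs_le_of_sq_le_sq key (by positivity)
  -- term 2: `|c(1+2H)/2 · v · B| ≤ c²(1+2H)²(a²/r²)/8 v² + ½A`
  have h2 : |c * (2⁻¹ * (1 + 2 * H) * v) * B| ≤
      c ^ 2 * (1 + 2 * H) ^ 2 * (a ^ 2 / radius a x ^ 2) / 8 * v ^ 2 + 2⁻¹ * A := by
    have key : (c * (2⁻¹ * (1 + 2 * H) * v) * B) ^ 2 ≤
        (c ^ 2 * (1 + 2 * H) ^ 2 * (a ^ 2 / radius a x ^ 2) / 8 * v ^ 2 + 2⁻¹ * A) ^ 2 := by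
      have e1 : (c * (2⁻¹ * (1 + 2 * H) * v) * B) ^ 2 = 4⁻¹ * c ^ 2 * (1 + 2 * H) ^ 2 * v ^ 2 * B ^ 2 := by ring
      have e2 : 4⁻¹ * c ^ 2 * (1 + 2 * H) ^ 2 * v ^ 2 * B ^ 2 ≤
          4⁻¹ * c ^ 2 * (1 + 2 * H) ^ 2 * v ^ 2 * (A * (a ^ 2 / radius a x ^ 2)) :=
        mul_le_mul_of_nonneg_left hB2 (by positivity)
      have e3 : 4⁻¹ * c ^ 2 * (1 + 2 * H) ^ 2 * v ^ 2 * (A * (a ^ 2 / radius a x ^ 2)) =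
          4 * (c ^ 2 * (1 + 2 * H) ^ 2 * (a ^ 2 / radius a x ^ 2) / 8 * v ^ 2) * (2⁻¹ * A) := by ring
      rw [e1]
      exact (e2.trans_eq e3).trans (four_mul_le_sq_add _ _)
    exact abs_le_of_sq_le_sq key (by positivity)
  have hsplit : c * (2⁻¹ * u + 2⁻¹ * (1 + 2 * H) * v) * B =
      c * (2⁻¹ * u) * B + c * (2⁻¹ * (1 + 2 * H) * v) * B := by ring
  rw [hsplit]
  have e1 := le_abs_self (c * (2⁻¹ * u) * B)
  have e2 := le_abs_self (c * (2⁻¹ * (1 + 2 * H) * v) * B)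
  linarith [h1, h2, e1, e2]

/-! ### The density of the `r^p`-current through a radial graph -/

/-- **The density of the `r^p`-current `J^{fm}` through the radial graph with conormal
`ν_c = dt* − c dr`**, for any coefficient field `φ g⁻¹_{M,a}` conformal to the Kerr one:
`−∑_μ (J^{fm}[φ g⁻¹])^μ (ν_c)_μ = φ f (½(1 + c) u² + ½((1 + 2H) − c(1 − 2H)) |p̸|² + c u B_r)`
(`T(fm, ·)` of a null vector `m`: no transversal derivative `v` at all). Through the outgoing null
cone (`c = c_null`) only `½(1 + c) f φ u²` survives — the boundary term `∫ r^p (∂_vΨ)² dv` of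
(p-WE); through a time slice (`c = 0`) it is `φ f (½u² + ½(1 + 2H)|p̸|²)`.
[cite: DafermosRodnianski2010ICMP, §3–§4] -/
theorem neg_sum_multiplierCurrent_smul_outVector_radialConormal (M a : ℝ) (hx : 0 < radius a x)
    (φ f : E4 → ℝ) (c : ℝ) (Φ : E4 → ℝ) :
    -∑ μ, KerrSchild.multiplierCurrent (fun y α β ↦ φ y * inverseMetric M a y α β)
        (fun y μ ↦ f y * outVector M a y μ) Φ x μ * radialConormal a x c μ =
      φ x * f x *
        (2⁻¹ * (1 + c) * frameOut M a x (fun μ ↦ fderiv ℝ Φ x (E4.basisVector μ)) ^ 2 +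
          2⁻¹ * ((1 + 2 * scalarH M a x) - c * (1 - 2 * scalarH M a x)) *
            frameAngSq a x (fun μ ↦ fderiv ℝ Φ x (E4.basisVector μ)) +
          c * frameOut M a x (fun μ ↦ fderiv ℝ Φ x (E4.basisVector μ)) *
            frameAng a x (fun μ ↦ fderiv ℝ Φ x (E4.basisVector μ)) (fun μ ↦ fderiv ℝ (radius a) x (E4.basisVector μ))) := by
  obtain ⟨p, hp⟩ : ∃ p : Fin 4 → ℝ, ∀ β, fderiv ℝ Φ x (E4.basisVector β) = p β := ⟨_, fun _ ↦ rfl⟩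
  have hpf : (fun μ ↦ fderiv ℝ Φ x (E4.basisVector μ)) = p := funext hp
  rw [KerrSchild.sum_multiplierCurrent_mul, hpf]
  simp only [hp]
  -- pull the conformal factor and `f` out of the sums
  have hG1 : ∑ μ, (∑ κ, φ x * inverseMetric M a x μ κ * p κ) * radialConormal a x c μ =
      φ x * ∑ μ, (∑ κ, inverseMetric M a x μ κ * p κ) * radialConormal a x c μ := by
    simp only [Fin.sum_univ_four]; ring
  have hG2 : ∑ α, ∑ β, φ x * inverseMetric M a x α β * p α * p β =
      φ x * ∑ α, ∑ β, inverseMetric M a x α β * p α * p β := by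
    simp only [Fin.sum_univ_four]; ring
  have hX1 : ∑ α, f x * outVector M a x α * p α = f x * frameOut M a x p := by
    simp only [frameOut, Fin.sum_univ_four]; ring
  have hX2 : ∑ μ, f x * outVector M a x μ * radialConormal a x c μ =
      f x * ∑ μ, outVector M a x μ * radialConormal a x c μ := by
    simp only [Fin.sum_univ_four]; ring
  rw [hG1, hG2, hX1, hX2, sum_sum_inverseMetric_mul_mul_eq_frame, sum_outVector_mul_radialConormal M hx,
    sum_inverseMetric_mul_mul_self_eq_frame, frameOut_radialConormal M hx, frameIn_radialConormal hx,
    frameAng_radialConormal]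
  ring

/-- **Through the time slices the `r^p`-current has nonnegative energy**: for `c = 0`,
`−∑ (J^{fm}[φg⁻¹])^μ (dt*)_μ = φ f (½ u² + ½(1 + 2H)|p̸|²) ≥ 0` whenever `φ f ≥ 0` and `M ≥ 0` — the
dominant energy condition for the future null multiplier `m` and the future timelike `V = −g♯dt*`,
explicitly; the sign that lets the smeared time cut-off of `KerrSchildTruncatedCurrent.lean` be
dropped. [cite: DafermosRodnianskiShlapentokhrothman2014, §2.3.1] -/
theorem neg_sum_multiplierCurrent_smul_outVector_timeConormal_nonneg (hM : 0 ≤ M) (hx : 0 < radius a x)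
    {φ f : E4 → ℝ} (hφf : 0 ≤ φ x * f x) (Φ : E4 → ℝ) :
    0 ≤ -∑ μ, KerrSchild.multiplierCurrent (fun y α β ↦ φ y * inverseMetric M a y α β)
        (fun y μ ↦ f y * outVector M a y μ) Φ x μ * radialConormal a x 0 μ := by
  rw [neg_sum_multiplierCurrent_smul_outVector_radialConormal M a hx φ f 0 Φ]
  refine mul_nonneg hφf ?_
  have hA := frameAngSq_nonneg hx (fun μ ↦ fderiv ℝ Φ x (E4.basisVector μ))
  have hH := scalarH_nonneg hM a x
  have hu : 0 ≤ frameOut M a x (fun μ ↦ fderiv ℝ Φ x (E4.basisVector μ)) ^ 2 := sq_nonneg _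
  have h1 : 0 ≤ 2⁻¹ * ((1 + 2 * scalarH M a x) - 0 * (1 - 2 * scalarH M a x)) *
      frameAngSq a x (fun μ ↦ fderiv ℝ Φ x (E4.basisVector μ)) :=
    mul_nonneg (by linarith) hA
  linarith [h1, hu]

end Literature.Geometry.Lorentzian.Kerr
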